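import Literature.NumberTheory.ComplexMultiplication.EllipticUnits.KatoEllipticZetaElement
import Literature.NumberTheory.ComplexMultiplication.EllipticUnits.RubinEulerSystem
import HarnessLib

set_option autoImplicit false

/-!
# Norm descent: the product of the `Gal(L/E)`-conjugates of `x ∈ L` lies in `E`, and its reading through an embedding

Topic `NumberTheory/ComplexMultiplication/EllipticUnits` (companion of `RubinEulerSystem.lean`'s `galOver`/`normOver` and of
`KatoEllipticZetaElement.lean`'s layers `katoLayer p 𝔣 n = K(pⁿ𝔣)`).  Cell `bsd-cm`, seat `bsd-cm-prr-ty1` g35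
(literature-prover), row K2C-15 of crux `stmt-BirchSwinnertonDyer-19945` (pen D1044 (C)/D1045, row card
`SUMMON-typers-K2C-13-16.md`): the predicate `GenusSeven.IsNormedEllipticUnitFamily F θu` (Summit side, `RamifiedSevenGenusKatoShapes`
l.124) asks that the genus unit `θu n ∈ F′_n ⊂ ℚ̄` be the image under an identification `e : K̄ → ℚ̄` of the product
`∏_{τ ∈ Gal(K(7^{n+1}𝔣)/K), τ|_{e⁻¹F′_n} = id} τ(z_n)` of the conjugates of a Kato unit representative `z_n ∈ K(7^{n+1}𝔣)`.  That
this product lies in `e⁻¹F′_n` — so that `θu n ∈ F′_n` — is the GALOIS DESCENT proved here in the generality of any finite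
Galois extension `L/K`, any intermediate field `E`, and any ring embedding `φ : L → M` reading `E` as the preimage of a
subfield `F′ ⊆ M` (de Shalit II.2.5: the norm `N_{K(𝔤)/K(𝔣)}` of an elliptic unit is the product of its conjugates and lies in
the smaller field).  Generic field theory; PROVED; no definition, no named fact (D-0026).

## Contents

* `finprod_mem_coe_subgroup_eq_prod` — `∏ᶠ τ ∈ H, f τ = ∏ τ : H, f τ` for a subgroup `H` of a finite Galois group.
* `smul_finprod_subgroup_eq` — `σ(∏_{τ ∈ H} τ x) = ∏_{τ ∈ H} τ x` for `σ ∈ H` (reindexing `τ ↦ στ`).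
* `finprod_subgroup_mem_fixedField` — `∏_{τ ∈ H} τ x ∈ L^H`.
* ★ `finprod_fixing_mem` — for `L/K` finite Galois and an intermediate field `E`:
  `∏ᶠ τ ∈ {τ | ∀ y ∈ E, τ y = y}, τ x ∈ E` (Galois correspondence `L^{Gal(L/E)} = E`).
* ★★ `map_finprod_fixing_preimage_mem` — the same read through a ring hom `φ : L →+* M` and a subfield `F′ ≤ M` containing
  `φ(K)`: `φ (∏ᶠ τ ∈ {τ | ∀ y, φ y ∈ F′ → τ y = y}, τ x) ∈ F′` — EXACTLY the index set of `IsNormedEllipticUnitFamily`.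
* `isIntegral_finprod_fixing` — the product of conjugates of an algebraic integer is an algebraic integer.

HONEST LABEL: generic Galois descent lemmas for the K2C-15 assembly (`exists_normedEllipticUnitFamily`, successor file
`Additive/NormedEllipticUnitFamilyOfFrame.lean`); nothing about elliptic units themselves is proved here; stmt-19945 OPEN; no
summit statement is proved by this seat; BSD is claimed for no curve.

References: [deShalit1987] II.2.5 Proposition (i) (norm relations, `N_{K(𝔤)/K(𝔣)}`); [Rubin1991] §1 (1c) (p. 28: the norm
operators `N_{F(𝔞)/F(𝔞/ℓ)}`); [NeukirchANT1999] Ch. IV §1 (Galois correspondence; the norm as the product of conjugates);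
[Kato2004Asterisque] §15.5 (p. 253: `_𝔞z_𝔣 ∈ K(𝔣)^×` and their norm compatibility).
-/

noncomputable section

namespace Literature.NumberTheory.ComplexMultiplication.EllipticUnits.NormDescent

section Generic

variable {K L : Type*} [Field K] [Field L] [Algebra K L]

/-- `∏ᶠ τ ∈ H, f τ = ∏ᶠ τ : H, f τ` for a subgroup `H` (the set-indexed and the subtype-indexed products agree).
[cite: NeukirchANT1999, Ch. IV §1 (Galois groups of finite extensions are finite)] -/
theorem finprod_mem_coe_subgroup_eq {M : Type*} [CommMonoid M] (H : Subgroup (L ≃ₐ[K] L)) (f : (L ≃ₐ[K] L) → M) :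
    ∏ᶠ τ ∈ (H : Set (L ≃ₐ[K] L)), f τ = ∏ᶠ τ : H, f τ :=
  (finprod_subtype_eq_finprod_cond (fun τ => τ ∈ H)).symm

/-- **`σ · ∏_{τ ∈ H} τ(x) = ∏_{τ ∈ H} τ(x)` for `σ ∈ H`** (reindex `τ ↦ στ`). [cite: NeukirchANT1999, Ch. IV §1 (the norm as product of conjugates is Galois invariant)] -/
theorem smul_finprod_subgroup_eq [FiniteDimensional K L] (H : Subgroup (L ≃ₐ[K] L)) (x : L) {σ : L ≃ₐ[K] L}
    (hσ : σ ∈ H) :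
    σ (∏ᶠ τ ∈ (H : Set (L ≃ₐ[K] L)), τ x) = ∏ᶠ τ ∈ (H : Set (L ≃ₐ[K] L)), τ x := by
  classical
  haveI : Fintype H := Fintype.ofFinite H
  rw [finprod_mem_coe_subgroup_eq, finprod_eq_prod_of_fintype, map_prod]
  exact Fintype.prod_equiv (Equiv.mulLeft (⟨σ, hσ⟩ : H)) (fun τ => σ ((τ : L ≃ₐ[K] L) x))
    (fun τ => (τ : L ≃ₐ[K] L) x) fun τ => by simp [AlgEquiv.mul_apply]

/-- **`∏_{τ ∈ H} τ(x) ∈ L^H`.** [cite: NeukirchANT1999, Ch. IV §1 (fixed fields)] -/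
theorem finprod_subgroup_mem_fixedField [FiniteDimensional K L] (H : Subgroup (L ≃ₐ[K] L)) (x : L) :
    ∏ᶠ τ ∈ (H : Set (L ≃ₐ[K] L)), τ x ∈ IntermediateField.fixedField H := by
  rw [IntermediateField.mem_fixedField_iff]
  intro σ hσ
  exact smul_finprod_subgroup_eq H x hσ

/-- The index set `{τ | τ fixes E pointwise}` is (the carrier of) `Gal(L/E) = E.fixingSubgroup`.
[cite: NeukirchANT1999, Ch. IV §1 (Galois correspondence)] -/
theorem setOf_forall_mem_apply_eq (E : IntermediateField K L) :
    {τ : L ≃ₐ[K] L | ∀ y ∈ E, τ y = y} = (E.fixingSubgroup : Set (L ≃ₐ[K] L)) := by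
  ext τ
  rw [Set.mem_setOf_eq, SetLike.mem_coe, IntermediateField.mem_fixingSubgroup_iff]

/-- ★ **NORM DESCENT**: for `L/K` finite Galois, an intermediate field `E` and `x ∈ L`, the product of the
`Gal(L/E)`-conjugates of `x` lies in `E` (`L^{Gal(L/E)} = E`). [cite: NeukirchANT1999, Ch. IV §1 (Hauptsatz der Galoistheorie; N_{L/E}(x) = ∏_σ σx ∈ E)]
[cite: deShalit1987, II.2.5 Proposition (i)] -/
theorem finprod_fixing_mem [FiniteDimensional K L] [IsGalois K L] (E : IntermediateField K L) (x : L) :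
    ∏ᶠ τ ∈ {τ : L ≃ₐ[K] L | ∀ y ∈ E, τ y = y}, τ x ∈ E := by
  rw [setOf_forall_mem_apply_eq E]
  have h := finprod_subgroup_mem_fixedField E.fixingSubgroup x
  rwa [IsGalois.fixedField_fixingSubgroup] at h

/-- ★★ **NORM DESCENT READ THROUGH AN EMBEDDING**: for `L/K` finite Galois, a ring hom `φ : L → M` into a field and a subfield
`F′ ⊆ M` containing `φ(K)`, the product of the conjugates `τ(x)` over the `τ ∈ Gal(L/K)` fixing every `y` with `φ(y) ∈ F′`
is mapped by `φ` into `F′` (apply `finprod_fixing_mem` to the intermediate field `φ⁻¹F′`).  This is the index set of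
`GenusSeven.IsNormedEllipticUnitFamily` (`L = K(7^{n+1}𝔣)`, `φ = e|_L`, `F′ = F′_n`).
[cite: deShalit1987, II.2.5 Proposition (i)] [cite: NeukirchANT1999, Ch. IV §1] -/
theorem map_finprod_fixing_preimage_mem [FiniteDimensional K L] [IsGalois K L] {M : Type*} [Field M] (φ : L →+* M)
    (F' : Subfield M) (hK : ∀ k : K, φ (algebraMap K L k) ∈ F') (x : L) :
    φ (∏ᶠ τ ∈ {τ : L ≃ₐ[K] L | ∀ y : L, φ y ∈ F' → τ y = y}, τ x) ∈ F' := by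
  let E : IntermediateField K L := (F'.comap φ).toIntermediateField fun k => by
    rw [Subfield.mem_comap]; exact hK k
  have hE : ∀ y : L, y ∈ E ↔ φ y ∈ F' := fun y => Subfield.mem_comap
  have hset : {τ : L ≃ₐ[K] L | ∀ y : L, φ y ∈ F' → τ y = y} = {τ : L ≃ₐ[K] L | ∀ y ∈ E, τ y = y} := by
    ext τ
    simp only [Set.mem_setOf_eq, hE]
  rw [hset, ← hE]
  exact finprod_fixing_mem E x

/-- **The product of the conjugates of an algebraic integer is an algebraic integer** (each `τ(x)` is integral, being the image
of `x` under a ring hom). [cite: NeukirchANT1999, Ch. I §2 (2.2)–(2.4) (integral elements form a ring; conjugates of integral elements are integral)] -/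
theorem isIntegral_finprod_mem [FiniteDimensional K L] (S : Set (L ≃ₐ[K] L)) {x : L} (hx : IsIntegral ℤ x) :
    IsIntegral ℤ (∏ᶠ τ ∈ S, τ x) := by
  classical
  rw [finprod_mem_eq_finite_toFinset_prod _ (Set.toFinite S)]
  exact IsIntegral.prod _ fun τ _ => hx.map (τ : L ≃ₐ[K] L).toAlgHom.toRingHom.toIntAlgHom

/-- The product of conjugates of a nonzero element is nonzero. [cite: NeukirchANT1999, Ch. IV §1] -/
theorem finprod_mem_apply_ne_zero [FiniteDimensional K L] (S : Set (L ≃ₐ[K] L)) {x : L} (hx : x ≠ 0) :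
    ∏ᶠ τ ∈ S, τ x ≠ 0 := by
  classical
  rw [finprod_mem_eq_finite_toFinset_prod _ (Set.toFinite S)]
  exact Finset.prod_ne_zero_iff.mpr fun τ _ => (map_ne_zero_iff _ (τ : L ≃ₐ[K] L).injective).mpr hx

/-- The product of conjugates of the inverse is the inverse of the product of conjugates. [cite: NeukirchANT1999, Ch. IV §1] -/
theorem finprod_mem_apply_inv [FiniteDimensional K L] (S : Set (L ≃ₐ[K] L)) (x : L) :
    ∏ᶠ τ ∈ S, τ x⁻¹ = (∏ᶠ τ ∈ S, τ x)⁻¹ := by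
  classical
  rw [finprod_mem_eq_finite_toFinset_prod _ (Set.toFinite S), finprod_mem_eq_finite_toFinset_prod _ (Set.toFinite S),
    ← Finset.prod_inv_distrib]
  exact Finset.prod_congr rfl fun τ _ => map_inv₀ _ _

end Generic

/-! ## The Kato-layer instance: `L = K(pⁿ𝔣) ⊂ K̄` -/

section KatoLayer

open scoped NumberField
open NumberField

variable {K : Type} [Field K] [NumberField K] (p : ℕ) (𝔣 : Ideal (𝓞 K)) (n : ℕ)

/-- ★ **Descent of the normed Kato unit**: for `z ∈ K(pⁿ𝔣)`, an embedding `e : K̄ → M` into a field and a subfield `F′ ⊆ M`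
containing `e(K)`, the product of the conjugates `τ(z)`, `τ ∈ Gal(K(pⁿ𝔣)/K)` fixing `e⁻¹F′ ∩ K(pⁿ𝔣)`, is mapped by `e` into
`F′` — the membership clause `θu n ∈ F′_n` of `GenusSeven.IsNormedEllipticUnitFamily` with its index set verbatim.
[cite: deShalit1987, II.2.5 Proposition (i)] [cite: Kato2004Asterisque, §15.5 (p. 253)] -/
theorem map_finprod_fixing_katoLayer_mem {M : Type*} [Field M] (e : AlgebraicClosure K →+* M) (F' : Subfield M)
    (hK : ∀ k : K, e (algebraMap K (AlgebraicClosure K) k) ∈ F') (z : katoLayer p 𝔣 n) :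
    e (((∏ᶠ τ ∈ {τ : katoLayer p 𝔣 n ≃ₐ[K] katoLayer p 𝔣 n |
          ∀ x : katoLayer p 𝔣 n, e (x : AlgebraicClosure K) ∈ F' → τ x = x}, τ z : katoLayer p 𝔣 n) :
        AlgebraicClosure K)) ∈ F' := by
  have h := map_finprod_fixing_preimage_mem (K := K) (e.comp (algebraMap (katoLayer p 𝔣 n) (AlgebraicClosure K))) F'
    (fun k => by rw [RingHom.comp_apply, ← IsScalarTower.algebraMap_apply]; exact hK k) z
  exact h

/-- Integrality of an element of the layer `K(pⁿ𝔣)` can be read in `K̄`. [cite: NeukirchANT1999, Ch. I §2 (2.2)–(2.4)] -/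
theorem isIntegral_coe_katoLayer_iff (w : katoLayer p 𝔣 n) :
    IsIntegral ℤ (w : AlgebraicClosure K) ↔ IsIntegral ℤ w :=
  isIntegral_algHom_iff (algebraMap (katoLayer p 𝔣 n) (AlgebraicClosure K)).toIntAlgHom
    (algebraMap (katoLayer p 𝔣 n) (AlgebraicClosure K)).injective

/-- **The normed unit is an algebraic integer** when `z` is. [cite: NeukirchANT1999, Ch. I §2 (2.2)–(2.4)] [cite: deShalit1987, II.2.5 Proposition (i)] -/
theorem isIntegral_coe_finprod_katoLayer (S : Set (katoLayer p 𝔣 n ≃ₐ[K] katoLayer p 𝔣 n)) {z : katoLayer p 𝔣 n}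
    (hz : IsIntegral ℤ (z : AlgebraicClosure K)) :
    IsIntegral ℤ (((∏ᶠ τ ∈ S, τ z : katoLayer p 𝔣 n)) : AlgebraicClosure K) := by
  rw [isIntegral_coe_katoLayer_iff]
  exact isIntegral_finprod_mem S ((isIntegral_coe_katoLayer_iff p 𝔣 n z).mp hz)

/-- **… and so is its inverse** when `z⁻¹` is (`(∏ τz)⁻¹ = ∏ τ(z⁻¹)`). [cite: NeukirchANT1999, Ch. I §2 (2.2)–(2.4)] [cite: deShalit1987, II.2.5 Proposition (i)] -/
theorem isIntegral_coe_finprod_katoLayer_inv (S : Set (katoLayer p 𝔣 n ≃ₐ[K] katoLayer p 𝔣 n)) {z : katoLayer p 𝔣 n}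
    (hz : IsIntegral ℤ (z : AlgebraicClosure K)⁻¹) :
    IsIntegral ℤ (((∏ᶠ τ ∈ S, τ z : katoLayer p 𝔣 n)) : AlgebraicClosure K)⁻¹ := by
  have h1 : (((∏ᶠ τ ∈ S, τ z : katoLayer p 𝔣 n)) : AlgebraicClosure K)⁻¹ =
      (((∏ᶠ τ ∈ S, τ z⁻¹ : katoLayer p 𝔣 n)) : AlgebraicClosure K) := by
    rw [finprod_mem_apply_inv]; push_cast; rfl
  have hz' : IsIntegral ℤ ((z⁻¹ : katoLayer p 𝔣 n) : AlgebraicClosure K) := by push_cast; exact hz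
  rw [h1]
  exact isIntegral_coe_finprod_katoLayer p 𝔣 n S hz'

/-- ★★ **THE NORMED UNIT AS A GLOBAL UNIT OF THE TARGET LAYER**: for a global unit `z ∈ K(pⁿ𝔣)` (integral with integral
inverse), an embedding `e : K̄ → k̄` and an intermediate field `F′ ⊆ k̄` containing `e(K)`, the image
`e(∏_{τ fixes e⁻¹F′} τ z)` is a GLOBAL UNIT OF `F′` (`globalUnitsOf F′`) — the two membership clauses of `θu n` in
`GenusSeven.IsNormedEllipticUnitFamily` (integrality is preserved by `τ` and `e`; membership by `map_finprod_fixing_katoLayer_mem`).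
[cite: deShalit1987, II.2.5 Proposition (i)] [cite: Kato2004Asterisque, §15.5 (p. 253) and 15.5 (1) (p. 254: units when 𝔣 has two prime divisors)] -/
theorem exists_globalUnit_eq_map_finprod_fixing {k : Type} [Field k] [NumberField k]
    (e : AlgebraicClosure K →+* AlgebraicClosure k) (F' : IntermediateField k (AlgebraicClosure k))
    (hK : ∀ c : K, e (algebraMap K (AlgebraicClosure K) c) ∈ F') {z : katoLayer p 𝔣 n}
    (hz : IsIntegral ℤ (z : AlgebraicClosure K)) (hz' : IsIntegral ℤ (z : AlgebraicClosure K)⁻¹)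
    (hz0 : (z : AlgebraicClosure K) ≠ 0) :
    ∃ u ∈ globalUnitsOf F', (u : AlgebraicClosure k) =
      e (((∏ᶠ τ ∈ {τ : katoLayer p 𝔣 n ≃ₐ[K] katoLayer p 𝔣 n |
          ∀ x : katoLayer p 𝔣 n, e (x : AlgebraicClosure K) ∈ F' → τ x = x}, τ z : katoLayer p 𝔣 n) :
        AlgebraicClosure K)) := by
  set S : Set (katoLayer p 𝔣 n ≃ₐ[K] katoLayer p 𝔣 n) :=
    {τ | ∀ x : katoLayer p 𝔣 n, e (x : AlgebraicClosure K) ∈ F' → τ x = x} with hS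
  set w : AlgebraicClosure K := (((∏ᶠ τ ∈ S, τ z : katoLayer p 𝔣 n)) : AlgebraicClosure K) with hw
  have hw0 : w ≠ 0 := by
    rw [hw]
    have hz0' : z ≠ 0 := fun h => hz0 (by rw [h]; rfl)
    exact_mod_cast finprod_mem_apply_ne_zero S hz0'
  have hew0 : e w ≠ 0 := (map_ne_zero_iff e e.injective).mpr hw0
  refine ⟨Units.mk0 (e w) hew0, ⟨?_, ?_, ?_⟩, rfl⟩
  · rw [Units.val_mk0]
    exact (isIntegral_coe_finprod_katoLayer p 𝔣 n S hz).map e.toIntAlgHom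
  · have h : ((Units.mk0 (e w) hew0)⁻¹ : (AlgebraicClosure k)ˣ).val = e w⁻¹ := by
      rw [Units.val_inv_eq_inv_val, Units.val_mk0, map_inv₀]
    rw [h]
    exact (isIntegral_coe_finprod_katoLayer_inv p 𝔣 n S hz').map e.toIntAlgHom
  · rw [Units.val_mk0, hw, hS]
    exact map_finprod_fixing_katoLayer_mem p 𝔣 n e F'.toSubfield hK z

end KatoLayer

end Literature.NumberTheory.ComplexMultiplication.EllipticUnits.NormDescent

end
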